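/-
Copyright (c) 2026 the pub-hodgecm-mathlib formalisation cell (harness21).  Prover seat hodgecm-mathlib-F0P3a-p08 (g26): N8-INNER road, brick «EP-ALL»
(the one-place Euler–Poincaré generator at EVERY elliptic class of `U(β₀)_w`, assembled from the regular, wall and scalar-corner generators).
-/
import Literature.NumberTheory.Rogawski1990.ArchEPGeneratorRegular              -- ★ (7) F7′ p852141: `epGeneratorAt_esymm3_of_injective` (regular elliptic classes)
import Literature.NumberTheory.Rogawski1990.ArchEPGeneratorWall                 -- ★ (8)(δ) p852272: `epGeneratorAt_esymm3_wall_of_mem_splitChartPlaces` (wall classes)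
import Literature.NumberTheory.Rogawski1990.ArchEPGeneratorCornerOnePlace       -- ★ (10)(C′) F-D′ p852289: `epGeneratorAt_scalar_corner_onePlace` (scalar corners, over ★ (B) p852226)
import Literature.NumberTheory.Rogawski1990.ArchEllipticClassTrichotomy         -- ★ p852179: `forall_unit_esymm3_of_regular_wall_corner_circle`
import Literature.NumberTheory.Rogawski1990.ArchInnerTwistChartDictionary       -- ★ `mem_splitChartPlaces_quasiSplitWeights`
import Literature.NumberTheory.Automorphic.ArchCongruenceOrbitalTransport       -- ★ `quasiSplitWeights_ne_zero`
import HarnessLib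

/-!
# The one-place Euler–Poincaré generator at EVERY elliptic class of `U(β₀)_w` (N8-INNER ROAD B, brick «EP-ALL»)

Topic `NumberTheory/Rogawski1990`; namespace `Literature.NumberTheory.Rogawski1990`.  THEOREMS ONLY (no `def`, no instance, no notation, no axiom, no named fact,
no `sorry`); kernel lane `--supports stmt-HodgeConjecture-24833`.  Cell `pub/hodgecm-mathlib`, crux H413; road N8-INNER (owner LH2-plan (g1)), brick «EP-ALL» PINNED
2026-09-02T17:30:57Z («THE name v10 consumes for `hEP`»), pen F0P3a-p08 (g26).  Count-neutral.

THE MATHEMATICS.  `β₀ = (½, 1, −½)` is the quasi-split house frame of `U(2,1)`: every complex place `w` of the CM field `L` is a split-chart place (★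
`mem_splitChartPlaces_quasiSplitWeights`), and `β₀` has non-zero entries (★ `quasiSplitWeights_ne_zero`).  E1's one-place head ★ `EPGeneratorAt L β₀ w ν_w b` (an `ε`-ball
about the class point `b ∈ ℂ³`; a one-place test function `f = fa ∘ ↑↑` with ZERO split reading near `b` and a smooth, non-vanishing compact STABLE reading `h ∘ class` near `b`)
is wanted by the EP assembly E3 — and by the leaf's v10 pay line as the binder `hEP` — at EVERY elliptic class `b = esymm3 l`, `|l_i| = 1`, for an ARBITRARY Borel structure and
right-invariant Haar measure `ν_w` at the place.  An elliptic class is REGULAR (`l` injective), a WALL (`esymm3 (u,u,v)`, `u ≠ v`) or a SCALAR CORNER (`(ζ,ζ,ζ)`) — ★ trichotomy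
`forall_unit_esymm3_of_regular_wall_corner_circle` — and the three generators are ★, all in the ONE-PLACE currency: (7) `epGeneratorAt_esymm3_of_injective` (a bump at a
regular point), (8) `epGeneratorAt_esymm3_wall_of_mem_splitChartPlaces` (the compact-wall representative and Harish-Chandra's compactness lemma), (10)
`epGeneratorAt_scalar_corner_onePlace` (ONE radial Cayley bump with a shell-null profile ★ (B), read through ★ (J)'s zero jumps and Glaeser at the corner ★ (C′), transported from
(J)'s family block to one place ★ F-D′).  This file is the three-line assembly: **`epGeneratorAt_esymm3_quasiSplit (L) (w) [..] (νw) [..] (l) (hl) : EPGeneratorAt L β₀ w νw (esymm3 l)`**,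
together with the hypothesis-generic form `epGeneratorAt_esymm3_quasiSplit_of_corner` (regular + wall discharged, the scalar corners as the only hypothesis) for frames or
consumers that carry their own corner head.
HONEST LABEL: HC_CM is proved only modulo the 7 printed citations (2 remaining: hLiu418 = `stmt-HodgeConjecture-24832`, h413 = `stmt-HodgeConjecture-24833`) until rung 0 closes;
this file is the `hEP` discharger of the EP assembly E3 ∕ the leaf's v10 pay line and pays nothing by itself.

## References
* [Rogawski1990] J. D. Rogawski, *Automorphic Representations of Unitary Groups in Three Variables*, Ann. of Math. Stud. 123 (1990), §3.6 p. 28, §8.2 p. 122, §14.1 p. 232.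
* [Shelstad1979] D. Shelstad, *Characters and inner forms of a quasi-split group over ℝ*, Compositio Math. 39 (1979), §4 pp. 22–26 (Lemma 4.2, Lemma 4.3).
* [Bouaziz1994IntegralesOrbitales] A. Bouaziz, *Intégrales orbitales sur les groupes de Lie réductifs*, Ann. Sci. ÉNS (4) 27 (1994), §6.2 pp. 591–594.
-/

set_option autoImplicit false

noncomputable section

open MeasureTheory MeasureTheory.Measure NumberField NumberField.InfinitePlace Matrix Complex Topology Metric Set Function
open Literature.NumberTheory.Automorphic Literature.NumberTheory.Automorphic.UnitaryGroup Literature.NumberTheory.Automorphic.ArchCartan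
open scoped MatrixGroups Matrix ContDiff Classical ENNReal

namespace Literature.NumberTheory.Rogawski1990

section Head

variable (L : Type) [Field L] [NumberField L] [IsCMField L] (w : {w : InfinitePlace L // IsComplex w})
  [MeasurableSpace ↥(archLocal L 3 (Matrix.diagonal ![(2 : L)⁻¹, 1, -(2 : L)⁻¹]) w)] [BorelSpace ↥(archLocal L 3 (Matrix.diagonal ![(2 : L)⁻¹, 1, -(2 : L)⁻¹]) w)]
  (νw : Measure ↥(archLocal L 3 (Matrix.diagonal ![(2 : L)⁻¹, 1, -(2 : L)⁻¹]) w)) [νw.IsHaarMeasure] [νw.IsMulRightInvariant]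

/-- **THE ONE-PLACE EP GENERATOR AT EVERY ELLIPTIC CLASS, GIVEN THE SCALAR CORNERS** (trichotomy assembly ★ `forall_unit_esymm3_of_regular_wall_corner_circle`: regular classes by ★
(7) `epGeneratorAt_esymm3_of_injective`, wall classes by ★ (8) `epGeneratorAt_esymm3_wall_of_mem_splitChartPlaces` — every complex place of the frame `β₀ = (½,1,−½)` is a
split-chart place ★ `mem_splitChartPlaces_quasiSplitWeights` — and the scalar corners by the hypothesis). [cite: Rogawski1990, §3.6 p. 28; §8.2 p. 122] [cite: Shelstad1979, §4 Lemma 4.2 p. 23] -/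
theorem epGeneratorAt_esymm3_quasiSplit_of_corner
    (hcorner : ∀ ζ : Circle, EPGeneratorAt L ![(2 : L)⁻¹, 1, -(2 : L)⁻¹] w νw (esymm3 fun _ : Fin 3 => (ζ : ℂ)))
    (l : Fin 3 → ℂ) (hl : ∀ i, ‖l i‖ = 1) :
    EPGeneratorAt L ![(2 : L)⁻¹, 1, -(2 : L)⁻¹] w νw (esymm3 l) :=
  forall_unit_esymm3_of_regular_wall_corner_circle (P := EPGeneratorAt L ![(2 : L)⁻¹, 1, -(2 : L)⁻¹] w νw)
    (fun _ hl hinj => epGeneratorAt_esymm3_of_injective L ![(2 : L)⁻¹, 1, -(2 : L)⁻¹] w νw (quasiSplitWeights_ne_zero L) hl hinj)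
    (fun u v huv => epGeneratorAt_esymm3_wall_of_mem_splitChartPlaces L ![(2 : L)⁻¹, 1, -(2 : L)⁻¹] w νw (quasiSplitWeights_ne_zero L)
      (mem_splitChartPlaces_quasiSplitWeights L w) u v huv)
    hcorner l hl

/-- **EP-ALL — THE ONE-PLACE EULER–POINCARÉ GENERATOR AT EVERY ELLIPTIC CLASS OF `U(β₀)_w`**: for every complex place `w` of the CM field `L`, every Borel structure and every
right-invariant Haar measure `ν_w` on `U(β₀)_w`, and every unit triple `l` (`|l_i| = 1`), E1's head `EPGeneratorAt L β₀ w ν_w (esymm3 l)` holds — regular classes ★ (7), wall classes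
★ (8), scalar corners ★ (10) `epGeneratorAt_scalar_corner_onePlace` (the radial Cayley bump with a shell-null profile), glued by the trichotomy of elliptic classes.  This is the `hEP`
binder of the EP assembly E3 (`∀ w [..] (νw) [..], ∀ l, (∀ i, ‖l i‖ = 1) → EPGeneratorAt L β₀ w νw (esymm3 l)`), discharged. [cite: Rogawski1990, §3.6 p. 28; §8.2 p. 122; §14.1 p. 232]
[cite: Shelstad1979, §4 Lemma 4.2 p. 23, Lemma 4.3 p. 25] [cite: Bouaziz1994IntegralesOrbitales, §6.2 p. 591] -/
theorem epGeneratorAt_esymm3_quasiSplit (l : Fin 3 → ℂ) (hl : ∀ i, ‖l i‖ = 1) :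
    EPGeneratorAt L ![(2 : L)⁻¹, 1, -(2 : L)⁻¹] w νw (esymm3 l) :=
  epGeneratorAt_esymm3_quasiSplit_of_corner L w νw (fun ζ => epGeneratorAt_scalar_corner_onePlace L w νw ζ) l hl

end Head

end Literature.NumberTheory.Rogawski1990

end
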